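import Summits.QuantumFields.BalabanUV.T4Continuum.Support.NE7CurvedGradLetter
import Summits.QuantumFields.BalabanUV.T4Continuum.Support.NE7CurvedSupLetter
import HarnessLib

/-!
# NE7CurvedGradLetterUniform — supplier stub (S-d′) CLOSED (ROAD-G107 §4, §7): THE CURVED C¹ SLICE LETTER WITH LOGARITHM, UNIFORM —
# `∃ K_G ε₀ > 0` (functions of `d`, `L`, `card n`): for every `k`, `N`, every unitary `(L^{k+1}N)`-periodic `W` in the multi-level small-field class with `SmallField W x`,
# `(L^{k+1})²·x ≤ ε₀`, every `Y ∈ 𝒯_E(W)` and every `B > 0` with `sup_{μ≠ν}‖curl_W Y‖ ≤ B`: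
# `‖Ad_{W(y+e_κ,μ)}Y(y+e_μ,κ) − Y(y,κ)‖ ≤ K_G·(1 + log L^{k+1})·B` at EVERY bond — k- and N-UNIFORM up to the junction logarithm (ROAD-G107 §2)

Cell `pub-balaban`, rung (B)+1 sub-cell t4, lineage `b2b-balaban-t4-ne7-p1`, generation 107 (CRUX PROVER NE7 #1 = OWNER of BINDER row NE7).
Memo `t4/b2b-balaban-t4-ne7-p1-g107/ROAD-G107.md` §7.  Over THIS GEN's pointwise letter `NE7CurvedGradLetter.grad_letter_at_point` (cut-off scale `K_b = 1`) and gen 101's sup letter (L)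
`NE7CurvedSupLetter.curved_sup_letter` (`S ≤ K_L·M·B`); the regime line of `divergence_sup_le` discharged from `M²x ≤ ε₀` as in gen 101 (`NE3TopRadiusLetters.loopRad_iterate_le_of_levelSmall`).
WHAT ([folklore]; 0 def, 0 sorry; dimension `d + 1 ≥ 3`, `L ≥ 2`).  **`curved_grad_letter`** (`K_G = 2c_δK_L + K_L + K(30(1 + 16c_δK_L + 2K_L) + 30(Γ₀K_L + 2d′c_δK_L + d′K_L)) + 1`, `ε₀ = min ε₁ (1∕E)`).
HONEST FRAMING (page 1): a linear a-priori estimate on OUR typed slice; constants existential; the logarithm is GENUINE (ROAD-G107 §2: no M-uniform letter exists on `𝒯_E`); nothing of Bałaban's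
asserted; NOT (S-g′) (the pair's `X_N`, the rate currency), NOT NE7; spine 0∕9; finite T⁴ rung (B)+1 — NOT infinite volume, NOT mass gap, NOT BetaPertH, NOT Clay.
-/

set_option autoImplicit false

open scoped BigOperators Matrix.Norms.L2Operator
open Finset

namespace Summit.QuantumFields.BalabanUV.T4Continuum.NE7CurvedGradLetterUniform

open Literature.MathematicalPhysics.QuantumFieldTheory.Balaban1983to89
open B7Prop1Explicit B7Prop2Explicit
open T4AveragingDeficitWall (IsUnitaryCfg SmallField Ad curlAt)
open T4AveragingDeficitWallBoundary (IsPeriodicCfg)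
open AveragingDeficitMultiLevelPrep (LevelSmall tower)
open AveragingDeficitTwoLevelPrep (prop1Radius)
open SpreadLift (loopRad)
open BlockAverageVaryHolo (nbRad)
open NE3TopRadiusLetters (loopRad_iterate_le_of_levelSmall)
open NE7MeanZeroGaugeSliceW (energyBlockLandauW)
open NE7CurvedGradLetter (grad_letter_at_point)
open NE7CurvedSupLetter (curved_sup_letter)

noncomputable section

variable {d : ℕ} {n : Type*} [Fintype n] [DecidableEq n]

set_option maxHeartbeats 800000 in
/-- **THE CURVED C¹ SLICE LETTER WITH LOGARITHM** — statement in the file header. [folklore] -/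
theorem curved_grad_letter [Nonempty n] (hd : 2 ≤ d) {L : ℕ} (hL : 2 ≤ L) :
    ∃ KG : ℝ, 0 < KG ∧ ∃ ε₀ : ℝ, 0 < ε₀ ∧ ∀ (k N : ℕ) [NeZero N] (W : Site (d + 1) → Fin (d + 1) → (Matrix n n ℂ)ˣ) (x : ℝ),
      IsUnitaryCfg W → IsPeriodicCfg W ((tower L N (k + 1) : ℕ) : ℤ) → 0 ≤ x → LevelSmall (d + 1) L k x → SmallField W x →
      ((L : ℝ) ^ (k + 1)) ^ 2 * x ≤ ε₀ →
      ∀ Y ∈ energyBlockLandauW (d := d + 1) (n := n) L N (k + 1) W, ∀ (B : ℝ), 0 < B →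
        (∀ (z : Site (d + 1)) (μ ν : Fin (d + 1)), μ ≠ ν → ‖curlAt W Y z μ ν‖ ≤ B) →
        ∀ (y : Site (d + 1)) (μ κ : Fin (d + 1)),
          ‖Ad (W (y + e κ) μ) (Y (y + e μ) κ) - Y y κ‖ ≤ KG * (1 + Real.log ((L : ℝ) ^ (k + 1))) * B := by
  obtain ⟨K, hK, hpt⟩ := grad_letter_at_point (d := d) (n := n) hd
  obtain ⟨KL, hKL, ε₁, hε₁, hsup⟩ := curved_sup_letter (d := d) (n := n) (by omega) hL
  have hL1 : 1 ≤ L := by omega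
  have hLr1 : (1 : ℝ) ≤ L := by exact_mod_cast hL1
  -- constants
  obtain ⟨d', hd'⟩ : ∃ d' : ℝ, d' = ((d + 1 : ℕ) : ℝ) := ⟨_, rfl⟩
  have hd'1 : (1 : ℝ) ≤ d' := by rw [hd']; exact_mod_cast (by omega : 1 ≤ d + 1)
  obtain ⟨C₃, hC₃⟩ : ∃ C₃ : ℕ, C₃ = 1 + nbRad (d + 1) L + 3 := ⟨_, rfl⟩
  obtain ⟨cδ, hcδ⟩ : ∃ cδ : ℝ, cδ = 2 * d' * (C₃ : ℝ) := ⟨_, rfl⟩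
  have hcδ0 : 0 ≤ cδ := by rw [hcδ]; positivity
  obtain ⟨Γ₀, hΓ₀⟩ : ∃ Γ₀ : ℝ, Γ₀ = 2 * (2 * d' + 4 * d' * d) := ⟨_, rfl⟩
  have hΓ₀0 : 0 ≤ Γ₀ := by rw [hΓ₀]; positivity
  -- the smallness: `ε = M²x ≤ ε₀` with `ε₀ ≤ ε₁`, `ε₀ ≤ 1` and the regime line
  obtain ⟨E, hE⟩ : ∃ E : ℝ, E = 1 + 2 * (4 * d' ^ 2 + 16 * d' * (17 * ((d' + 1) * (d' + 4)))) := ⟨_, rfl⟩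
  have hE1 : 1 ≤ E := by rw [hE]; exact le_add_of_nonneg_right (by positivity)
  have hE0 : 0 < E := by linarith
  -- the constant: every term is `≤ (…)·B·(1 + log M)`; `log(2·14M) ≤ log 28 + log M ≤ 28 + log M`
  obtain ⟨KG, hKG⟩ : ∃ KG : ℝ, KG = 2 * cδ * KL + KL + K * ((1 + 16 * cδ * KL + 2 * KL) * 30 + 30 * (Γ₀ * KL + d' * 2 * cδ * KL + d' * KL)) + 1 := ⟨_, rfl⟩
  have hKGpos : 0 < KG := by rw [hKG]; positivity
  refine ⟨KG, hKGpos, min ε₁ (1 / E), lt_min hε₁ (by positivity), ?_⟩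
  intro k N _ W x hWu hWP hx hs hWx hε Y hY B hBpos hB y μ κ
  haveI : NeZero L := ⟨by omega⟩
  have hB0 : 0 ≤ B := hBpos.le
  have hM1 : 1 ≤ L ^ (k + 1) := Nat.one_le_pow _ _ hL1
  obtain ⟨Mr, hMr⟩ : ∃ Mr : ℝ, Mr = (L : ℝ) ^ (k + 1) := ⟨_, rfl⟩
  have hMrc : ((L ^ (k + 1) : ℕ) : ℝ) = Mr := by rw [hMr]; push_cast; ring
  have hMr1 : 1 ≤ Mr := by rw [← hMrc]; exact_mod_cast hM1
  have hMr0 : 0 < Mr := by linarith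
  obtain ⟨ε, hεdef⟩ : ∃ ε : ℝ, ε = Mr ^ 2 * x := ⟨_, rfl⟩
  have hε0 : 0 ≤ ε := by rw [hεdef]; positivity
  have hεε₁ : ((L : ℝ) ^ (k + 1)) ^ 2 * x ≤ ε₁ := hε.trans (min_le_left _ _)
  have hεE : ε * E ≤ 1 := by
    have := hε.trans (min_le_right _ _); rw [hεdef, hMr]; rwa [le_div_iff₀ hE0] at this
  have hε1 : ε ≤ 1 := by have := mul_le_mul_of_nonneg_left hE1 hε0; linarith
  -- the sup letter (L)
  have hS : ∀ w μ', ‖Y w μ'‖ ≤ KL * Mr * B := fun w μ' => by rw [hMr]; exact hsup k N W x hWu hWP hx hs hWx hεε₁ Y hY B hB w μ'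
  set S : ℝ := KL * Mr * B with hSdef
  have hS0 : 0 ≤ S := by positivity
  -- the letters of the pointwise theorem at `K_b = 1`
  obtain ⟨δs, hδs⟩ : ∃ δs : ℝ, δs = (((d + 1 : ℕ) : ℝ) * ((((2 * (L ^ (k + 1) * C₃) + 1 : ℕ) : ℝ)) - 1)) * x := ⟨_, rfl⟩
  obtain ⟨g₁, hg₁⟩ : ∃ g₁ : ℝ, g₁ = 1 / ((L ^ (k + 1) * 1 : ℕ) : ℝ) := ⟨_, rfl⟩
  obtain ⟨G, hGdef⟩ : ∃ G : ℝ, G = 2 * (2 * ((d + 1 : ℕ) : ℝ) + 4 * ((d + 1 : ℕ) : ℝ) * ((((d + 1 : ℕ) : ℝ)) - 1) * (((L : ℝ) ^ (k + 1)) ^ 2 * x)) * S / (L : ℝ) ^ (k + 1) :=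
    ⟨_, rfl⟩
  -- the regime line of `divergence_sup_le`
  have hθB1 : 4 * (((d + 1 : ℕ) : ℝ)) ^ 2 * ((L : ℝ) ^ (k + 1) - 1) ^ 2 * x + 16 * ((d + 1 : ℕ) : ℝ) * loopRad (d + 1) L ((prop1Radius (d + 1) L)^[k] x) ≤ 1 / 2 := by
    have hl := loopRad_iterate_le_of_levelSmall (d := d + 1) hL k hx hs
    have h1 : ((L : ℝ) ^ (k + 1) - 1) ^ 2 * x ≤ ε := by
      rw [hεdef, hMr]; exact mul_le_mul_of_nonneg_right (by nlinarith only [hMr1, hMr]) hx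
    have hE2 : 2 * (4 * d' ^ 2 + 16 * d' * (17 * ((d' + 1) * (d' + 4)))) * ε ≤ 1 := by
      have hle : 2 * (4 * d' ^ 2 + 16 * d' * (17 * ((d' + 1) * (d' + 4)))) ≤ E := by rw [hE]; linarith
      have := mul_le_mul_of_nonneg_left hle hε0
      linarith only [this, hεE]
    rw [← hd'] at hl ⊢
    rw [← hMr, ← hεdef] at hl
    have hd'0 : 0 ≤ d' := by linarith
    have hl' := mul_le_mul_of_nonneg_left hl (by positivity : (0 : ℝ) ≤ 16 * d')
    have h1' := mul_le_mul_of_nonneg_left h1 (by positivity : (0 : ℝ) ≤ 4 * d' ^ 2)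
    linarith only [hl', h1', hE2]
  -- THE POINTWISE LETTER
  have key := hpt hL k N W x hWu hWP hx hs hWx Y hY B hBpos hB S hS0 hS y μ κ 1 C₃ le_rfl hC₃ δs g₁ G hδs hg₁ hGdef hθB1
  -- sizes of the letters: `δs·S ≤ cδ·KL·B`, `g₁·S = KL·B`, `G ≤ Γ₀·KL·B`
  have hδs0 : 0 ≤ δs := by
    rw [hδs]
    refine mul_nonneg (mul_nonneg (by positivity) ?_) hx
    have : (1 : ℝ) ≤ (((2 * (L ^ (k + 1) * C₃) + 1 : ℕ)) : ℝ) := by exact_mod_cast (by omega : 1 ≤ 2 * (L ^ (k + 1) * C₃) + 1)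
    linarith
  have hMδs : Mr * δs = cδ * ε := by rw [hδs, hcδ, hεdef, hd', hMr]; push_cast; ring
  have hδS : δs * S ≤ cδ * KL * B := by
    have e1 : δs * S = cδ * ε * (KL * B) := by rw [hSdef, ← hMδs]; ring
    rw [e1]
    have : cδ * ε * (KL * B) ≤ cδ * 1 * (KL * B) := by gcongr
    linarith
  have hg₁S : g₁ * S = KL * B := by
    have hMK : ((L ^ (k + 1) * 1 : ℕ) : ℝ) = Mr := by rw [mul_one, hMrc]
    rw [hg₁, hMK, hSdef]; field_simp
  have hg₁0 : 0 ≤ g₁ := by rw [hg₁]; positivity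
  have hGle : G ≤ Γ₀ * KL * B := by
    rw [hGdef, ← hMr, ← hεdef, ← hd', hΓ₀, hSdef]
    have hdd : d' - 1 = (d : ℝ) := by rw [hd']; push_cast; ring
    rw [hdd]
    have h2 : 2 * (2 * d' + 4 * d' * (d : ℝ) * ε) ≤ 2 * (2 * d' + 4 * d' * d) := by
      have hdd0 : 0 ≤ d' * (d : ℝ) := by positivity
      nlinarith
    have e : 2 * (2 * d' + 4 * d' * (d : ℝ) * ε) * (KL * Mr * B) / Mr = 2 * (2 * d' + 4 * d' * (d : ℝ) * ε) * (KL * B) := by field_simp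
    rw [e]
    have := mul_le_mul_of_nonneg_right h2 (by positivity : 0 ≤ KL * B)
    linarith
  have hG0 : 0 ≤ G := by
    rw [hGdef, ← hMr]
    refine div_nonneg (mul_nonneg (mul_nonneg (by norm_num) ?_) hS0) hMr0.le
    have h2 : 0 ≤ ((d + 1 : ℕ) : ℝ) - 1 := by rw [← hd']; linarith
    positivity
  -- the logarithms: `P = 14·M`, `log⁺(28M) ≤ 28 + log M`... via `log t ≤ t − 1` on the numeric factor and `log(aM) = log a + log M`
  have hlogM : 0 ≤ Real.log Mr := Real.log_nonneg hMr1
  have hP : (L : ℝ) ^ (k + 1) * ((2 * 1 + 12 : ℕ) : ℝ) = 14 * Mr := by rw [hMr]; push_cast; ring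
  have hlog1 : Real.posLog (2 * (14 * Mr)) ≤ 28 + Real.log Mr := by
    have h28 : (1 : ℝ) ≤ |28 * Mr| := by rw [abs_of_pos (by positivity)]; linarith
    rw [show 2 * (14 * Mr) = 28 * Mr by ring, Real.posLog_eq_log h28, Real.log_mul (by norm_num) hMr0.ne']
    have := Real.log_le_sub_one_of_pos (by norm_num : (0:ℝ) < 28)
    linarith
  have hlog2 : Real.log (14 * Mr) ≤ 14 + Real.log Mr := by
    rw [Real.log_mul (by norm_num) hMr0.ne']
    have := Real.log_le_sub_one_of_pos (by norm_num : (0:ℝ) < 14)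
    linarith
  rw [hP] at key
  -- assemble: every term `≤ (coefficient)·B·(1 + log M)`
  have hlog30 : 1 + Real.posLog (2 * (14 * Mr)) ≤ 30 * (1 + Real.log Mr) := by linarith
  have hlog30' : 1 + Real.log (14 * Mr) ≤ 30 * (1 + Real.log Mr) := by linarith
  have hBZ : B + 16 * δs * S + 2 * g₁ * S ≤ (1 + 16 * cδ * KL + 2 * KL) * B := by linarith
  have hBZ0 : 0 ≤ B + 16 * δs * S + 2 * g₁ * S := by positivity
  have hd'0 : 0 ≤ d' := by linarith
  have hGb : G + ((d + 1 : ℕ) : ℝ) * (2 * δs * S) + ((d + 1 : ℕ) : ℝ) * g₁ * S ≤ (Γ₀ * KL + d' * 2 * cδ * KL + d' * KL) * B := by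
    rw [← hd']
    have p1 : d' * (δs * S) ≤ d' * (cδ * KL * B) := mul_le_mul_of_nonneg_left hδS hd'0
    have p2 : d' * (g₁ * S) = d' * (KL * B) := by rw [hg₁S]
    linarith
  have hGb0 : 0 ≤ G + ((d + 1 : ℕ) : ℝ) * (2 * δs * S) + ((d + 1 : ℕ) : ℝ) * g₁ * S := by positivity
  have h1L : 0 ≤ 1 + Real.log Mr := by linarith
  have t1 : (B + 16 * δs * S + 2 * g₁ * S) * (1 + Real.posLog (2 * (14 * Mr))) ≤ ((1 + 16 * cδ * KL + 2 * KL) * B) * (30 * (1 + Real.log Mr)) :=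
    mul_le_mul hBZ hlog30 (by linarith [Real.posLog_nonneg (x := 2 * (14 * Mr))]) (by positivity)
  have t2 : (1 + Real.log (14 * Mr)) * (G + ((d + 1 : ℕ) : ℝ) * (2 * δs * S) + ((d + 1 : ℕ) : ℝ) * g₁ * S)
      ≤ (30 * (1 + Real.log Mr)) * ((Γ₀ * KL + d' * 2 * cδ * KL + d' * KL) * B) :=
    mul_le_mul hlog30' hGb hGb0 (by positivity)
  have t3 : 2 * δs * S + g₁ * S ≤ (2 * cδ * KL + KL) * B * (1 + Real.log Mr) := by
    have : (2 * cδ * KL + KL) * B ≤ (2 * cδ * KL + KL) * B * (1 + Real.log Mr) := le_mul_of_one_le_right (by positivity) (by linarith)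
    linarith
  rw [hMr] at *
  calc ‖Ad (W (y + e κ) μ) (Y (y + e μ) κ) - Y y κ‖ ≤ _ := key
    _ ≤ (2 * cδ * KL + KL) * B * (1 + Real.log ((L : ℝ) ^ (k + 1)))
        + K * (((1 + 16 * cδ * KL + 2 * KL) * B) * (30 * (1 + Real.log ((L : ℝ) ^ (k + 1))))
          + (30 * (1 + Real.log ((L : ℝ) ^ (k + 1)))) * ((Γ₀ * KL + d' * 2 * cδ * KL + d' * KL) * B)) := by
        have := mul_le_mul_of_nonneg_left (add_le_add t1 t2) hK
        linarith
    _ ≤ KG * (1 + Real.log ((L : ℝ) ^ (k + 1))) * B := by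
        rw [hKG]
        have h0 : 0 ≤ B * (1 + Real.log ((L : ℝ) ^ (k + 1))) := by positivity
        linarith

end

end Summit.QuantumFields.BalabanUV.T4Continuum.NE7CurvedGradLetterUniform
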